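import Summits.AtomisticToContinuum.HydrodynamicLimit.Theorems.OneFlightGossipEngineEquilibriumClampedCollisionalWindowLDDefs

/-!
# Stub `stub_coinBudgetLD` (S4) of line `coarse-coin-entropy-chain` — pathwise by-products and the exact reduction
(crux stmt-AtomisticToContinuum-13733, repair C′ = `ClampedTransferWindowLD`; vocabulary module `…WindowLDDefs`)

S4 asks, under the canonical Gibbs law `G_N`, uniformly in the horizon `H` and the row `r`, for
`∫ exp(Σ_{n<H} min(32 t²L² x_n², 16 tL x_n)) dG_N ≤ exp(ε(N+1))`, `x_n = w⁻¹ ρ_n` (`coinRange`), `t ≤ t₀(V, L)`, `τ ≥ τ₀(ε)`.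
This file does NOT prove S4 (stub-worker verdict `stub-blocked`, `work/stubs/CoinBudget-REPORT.md`: its core is an
`N`-uniform equilibrium exponential moment, with vanishing pressure as `τ → ∞`, of the `|g|²`-weighted window collision
count — no engine in the tree). Proved here, sorry-free, in the sub-namespace `CoinBudget`:
* §1 `flagP ∈ [0,1]`, `rangeBase ≥ 0`, ≤ 2 ordered contact pairs at any time of a good orbit, hence `0 ≤ ρ_n ≤ wV`,
  `ρ_n = 0` beyond `coinCount` / off the good set, `0 ≤ x_n ≤ V`; `‖v′ − w′‖ = ‖v − w‖`, so `rangeBase` is symmetric in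
  the ordered pair and AT A COIN `ρ_n = ω̃⁻_i ω̃⁻_j · min(rangeBase, wV)` (`coinRange_eq_of_mem_contactPairs`);
* §2 `min(32(tL)²x², 16tLx) ≤ 32(tL)²x²`, `≤ 16tLV`; `Σ_{n<H} ≤ 16tLV·min(H, coinCount)` (useless for S4: `coinCount` is
  extensive in `τ`) and `Σ min(…) ≤ 32(tL)² Σ x_n²`, with EQUALITY once `2tLV ≤ 1`;
* (§3, companion file `StubCoinBudgetLDClamp.lean`) clamp exhaustion: `Σ_k 1{Σ_{l<k} a_l ≤ B}·min(a_k, B) ≤ min(Σ a, 2B)`;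
* §4 THE EXACT REDUCTION: S4's conclusion ⇔ the exponential moment of the QUADRATIC coin budget `κ Σ_{n<H} x_n²`,
  `0 ≤ κ ≤ κ₀(V)` (`coinBudgetLD_of_quadratic`, `quadratic_of_coinBudgetLD`; statements inline, no `def … : Prop`).
prover-line-stmt-AtomisticToContinuum-13733-1 (stub worker S4), 2026-08-16.
-/
noncomputable section

open MeasureTheory ProbabilityTheory Set Filter
open scoped ENNReal BigOperators
open Literature.Analysis.FluidPDE Literature.MathematicalPhysics.KineticTheory
open Literature.Analysis.FunctionSpaces (Torus.partialDeriv Torus.IsSmooth)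

namespace Summit.AtomisticToContinuum.HydrodynamicLimit.Theorems.ClampedTransferCoin

namespace CoinBudget

/-! ## § 1 Ranges: flags, `rangeBase`, two records per coin, `0 ≤ ρ_n ≤ wV` -/

section Ranges

variable {σ τ V : ℝ} {N : ℕ}

/-- The predictable clamp is nonnegative. -/
theorem flagP_nonneg (σ τ V : ℝ) (Φ : Flow σ N) (t : ℝ) (i : Fin (N + 1)) (z : Phase N) :
    0 ≤ flagP σ τ V Φ t i z := by
  unfold flagP; split_ifs <;> norm_num

/-- The predictable clamp is at most one. -/
theorem flagP_le_one (σ τ V : ℝ) (Φ : Flow σ N) (t : ℝ) (i : Fin (N + 1)) (z : Phase N) :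
    flagP σ τ V Φ t i z ≤ 1 := by
  unfold flagP; split_ifs <;> norm_num

/-- A product of two predictable clamps is at most one. -/
theorem flagP_mul_flagP_le_one (σ τ V : ℝ) (Φ : Flow σ N) (s t : ℝ) (i j : Fin (N + 1)) (z : Phase N) :
    flagP σ τ V Φ s i z * flagP σ τ V Φ t j z ≤ 1 :=
  mul_le_one₀ (flagP_le_one σ τ V Φ s i z) (flagP_nonneg σ τ V Φ t j z) (flagP_le_one σ τ V Φ t j z)

/-- The window is nonnegative for `τ ≥ 0`. -/
theorem window_nonneg (hτ : 0 ≤ τ) (N : ℕ) : 0 ≤ window τ N :=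
  mul_nonneg hτ (Real.rpow_nonneg (by positivity) _)

/-- The diameter is nonnegative for `σ ≥ 0`. -/
theorem hsDiameter_nonneg (hσ : 0 ≤ σ) (N : ℕ) : 0 ≤ hsDiameter σ N := by
  unfold hsDiameter; positivity

/-- The kinematic range of a record is nonnegative (every row). -/
theorem rangeBase_nonneg (hσ : 0 ≤ σ) (N : ℕ) (r : Option (Fin 3)) (c : Rec N) : 0 ≤ rangeBase σ N r c := by
  have hε : 0 ≤ hsDiameter σ N := hsDiameter_nonneg hσ N
  cases r with
  | none => simp only [rangeBase]; positivity
  | some k => simp only [rangeBase]; positivity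

/-- The per-record summand of `coinRange` is nonnegative. -/
theorem summand_nonneg (hσ : 0 ≤ σ) (hτ : 0 ≤ τ) (hV : 0 ≤ V) (Φ : Flow σ N) (r : Option (Fin 3))
    (z : Phase N) (c : Rec N) :
    0 ≤ flagP σ τ V Φ c.time c.fst z * flagP σ τ V Φ c.time c.snd z *
      min (rangeBase σ N r c) (window τ N * V) / 2 := by
  have h1 := flagP_nonneg σ τ V Φ c.time c.fst z
  have h2 := flagP_nonneg σ τ V Φ c.time c.snd z
  have h3 : 0 ≤ min (rangeBase σ N r c) (window τ N * V) :=
    le_min (rangeBase_nonneg hσ N r c) (mul_nonneg (window_nonneg hτ N) hV)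
  positivity

/-- The per-record summand of `coinRange` is at most `wV/2`. -/
theorem summand_le (hσ : 0 ≤ σ) (hτ : 0 ≤ τ) (hV : 0 ≤ V) (Φ : Flow σ N) (r : Option (Fin 3))
    (z : Phase N) (c : Rec N) :
    flagP σ τ V Φ c.time c.fst z * flagP σ τ V Φ c.time c.snd z *
        min (rangeBase σ N r c) (window τ N * V) / 2 ≤ window τ N * V / 2 := by
  have h3 : 0 ≤ min (rangeBase σ N r c) (window τ N * V) :=
    le_min (rangeBase_nonneg hσ N r c) (mul_nonneg (window_nonneg hτ N) hV)
  have h4 : flagP σ τ V Φ c.time c.fst z * flagP σ τ V Φ c.time c.snd z *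
      min (rangeBase σ N r c) (window τ N * V) ≤ min (rangeBase σ N r c) (window τ N * V) :=
    mul_le_of_le_one_left h3 (flagP_mul_flagP_le_one σ τ V Φ _ _ _ _ z)
  linarith [min_le_right (rangeBase σ N r c) (window τ N * V)]

/-- Along a hard-sphere trajectory in a regular geometry at most two ORDERED pairs are in contact at any time: none
off the collision times, exactly the colliding pair in its two orders at a collision. -/
theorem card_contactPairs_le_two_of_trajectory {d X : Type*} [Fintype d] [TopologicalSpace X] {G : Geometry d X}
    {ε : ℝ} {M : ℕ} {γ : ℝ → Config M d X} (hγ : IsHardSphereTrajectory G ε M γ) (hG : G.IsHardSphereRegular ε)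
    (t : ℝ) : (contactPairs G ε (γ t)).card ≤ 2 := by
  by_cases ht : t ∈ collisionTimes G ε γ
  · exact (hγ.card_contactPairs_eq_two hG ht).le
  · rw [contactPairs_eq_empty_of_not_mem ht, Finset.card_empty]
    norm_num

/-- `ε_N < 1/2` for `0 ≤ σ < 1/2` (the torus geometry is then regular). -/
theorem hsDiameter_lt_half (hσ : 0 ≤ σ) (hσ2 : σ < 1 / 2) (N : ℕ) : hsDiameter σ N < 2⁻¹ :=
  (hsDiameter_le hσ N).trans_lt (by rw [inv_eq_one_div]; exact hσ2)

/-- On a good orbit (torus geometry regular since `ε_N ≤ σ < 1/2`) at most two ORDERED pairs are in contact at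
any time. -/
theorem card_contactPairs_flow_le_two (hσ : 0 ≤ σ) (hσ2 : σ < 1 / 2) (Φ : Flow σ N) {z : Phase N}
    (hz : z ∈ Φ.good) (t : ℝ) :
    (contactPairs (Torus.geometry (Fin 3)) (hsDiameter σ N) (Φ.flow t z)).card ≤ 2 := by
  have h := card_contactPairs_le_two_of_trajectory (Φ.isTrajectory z hz)
    (Torus.isHardSphereRegular_geometry (d := Fin 3) (hsDiameter_lt_half hσ hσ2 N)) t
  exact h

/-- `ρ_n ≥ 0`. -/
theorem coinRange_nonneg (hσ : 0 ≤ σ) (hτ : 0 ≤ τ) (hV : 0 ≤ V) (Φ : Flow σ N) (r : Option (Fin 3)) (n : ℕ)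
    (z : Phase N) : 0 ≤ coinRange σ τ V Φ r n z := by
  unfold coinRange
  split_ifs with h
  · exact Finset.sum_nonneg fun p _ => summand_nonneg hσ hτ hV Φ r z _
  · exact le_rfl

/-- **`ρ_n ≤ w V`**: two records at most, each worth at most `wV/2`. -/
theorem coinRange_le_window_mul (hσ : 0 ≤ σ) (hσ2 : σ < 1 / 2) (hτ : 0 ≤ τ) (hV : 0 ≤ V) (Φ : Flow σ N)
    (r : Option (Fin 3)) (n : ℕ) (z : Phase N) : coinRange σ τ V Φ r n z ≤ window τ N * V := by
  have hwV : 0 ≤ window τ N * V := mul_nonneg (window_nonneg hτ N) hV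
  unfold coinRange
  split_ifs with h
  · refine (Finset.sum_le_card_nsmul _ _ (window τ N * V / 2) fun p _ => summand_le hσ hτ hV Φ r z _).trans ?_
    rw [nsmul_eq_mul]
    have hc : ((contactPairs (Torus.geometry (Fin 3)) (hsDiameter σ N) (Φ.flow (coinTime Φ z n) z)).card : ℝ) ≤ 2 := by
      exact_mod_cast card_contactPairs_flow_le_two hσ hσ2 Φ h.1 _
    nlinarith
  · exact hwV

/-- Beyond the coin count the range vanishes. -/
theorem coinRange_eq_zero_of_le (Φ : Flow σ N) (r : Option (Fin 3)) {n : ℕ} {z : Phase N}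
    (hn : coinCount σ τ Φ z ≤ n) : coinRange σ τ V Φ r n z = 0 := by
  unfold coinRange
  split_ifs with h
  · exact absurd h.2 (not_lt.2 hn)
  · rfl

/-- Off the good set the range vanishes. -/
theorem coinRange_eq_zero_of_not_mem (Φ : Flow σ N) (r : Option (Fin 3)) (n : ℕ) {z : Phase N}
    (hz : z ∉ Φ.good) : coinRange σ τ V Φ r n z = 0 := by
  unfold coinRange
  split_ifs with h
  · exact absurd h.1 hz
  · rfl

/-- `x_n = w⁻¹ ρ_n ≥ 0`. -/
theorem coinRangeNorm_nonneg (hσ : 0 ≤ σ) (hτ : 0 < τ) (hV : 0 ≤ V) (Φ : Flow σ N) (r : Option (Fin 3))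
    (n : ℕ) (z : Phase N) : 0 ≤ (window τ N)⁻¹ * coinRange σ τ V Φ r n z :=
  mul_nonneg (inv_nonneg.2 (window_pos hτ N).le) (coinRange_nonneg hσ hτ.le hV Φ r n z)

/-- `x_n = w⁻¹ ρ_n ≤ V`. -/
theorem coinRangeNorm_le (hσ : 0 ≤ σ) (hσ2 : σ < 1 / 2) (hτ : 0 < τ) (hV : 0 ≤ V) (Φ : Flow σ N)
    (r : Option (Fin 3)) (n : ℕ) (z : Phase N) : (window τ N)⁻¹ * coinRange σ τ V Φ r n z ≤ V := by
  rw [inv_mul_le_iff₀ (window_pos hτ N)]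
  exact coinRange_le_window_mul hσ hσ2 hτ.le hV Φ r n z

-- adapted from Cruxes/OddContactSymmetry/IdeatorFiveSketch.lean (`norm_relVel_reflectVel`)
/-- The relative speed is a collision invariant: `‖v′ − w′‖ = ‖v − w‖`. -/
theorem norm_relVel_reflectVel (n : V3) (p : V3 × V3) :
    ‖(reflectVel n p).1 - (reflectVel n p).2‖ = ‖p.1 - p.2‖ := by
  have hE := norm_sq_reflectVel_fst_add_norm_sq_reflectVel_snd n p
  have hP := reflectVel_fst_add_reflectVel_snd n p
  have h1 := norm_sub_sq_real (reflectVel n p).1 (reflectVel n p).2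
  have h2 := norm_add_sq_real (reflectVel n p).1 (reflectVel n p).2
  have h3 := norm_sub_sq_real p.1 p.2
  have h4 := norm_add_sq_real p.1 p.2
  have hsq : ‖(reflectVel n p).1 - (reflectVel n p).2‖ ^ 2 = ‖p.1 - p.2‖ ^ 2 := by
    rw [hP] at h2
    linarith
  exact (pow_left_inj₀ (norm_nonneg _) (norm_nonneg _) two_ne_zero).mp hsq

/-- `rangeBase` of the record of `(i, j)` read off a configuration, momentum rows: `ε_N ‖v_i − v_j‖` in the
(post-collisional) velocities of the configuration. -/
theorem rangeBase_ofConfig_some (σ : ℝ) (N : ℕ) (k : Fin 3) (z : Phase N) (t : ℝ) (i j : Fin (N + 1)) :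
    rangeBase σ N (some k) (HardSphereCollisionRecord.ofConfig (Torus.geometry (Fin 3)) (hsDiameter σ N) z t i j) =
      hsDiameter σ N * ‖(z i).2 - (z j).2‖ := by
  simp only [rangeBase, HardSphereCollisionRecord.ofConfig_preVel, norm_relVel_reflectVel]

/-- `rangeBase` of the record of `(i, j)` read off a configuration, energy row:
`ε_N ‖v_i − v_j‖ · ‖v_i + v_j‖/2`. -/
theorem rangeBase_ofConfig_none (σ : ℝ) (N : ℕ) (z : Phase N) (t : ℝ) (i j : Fin (N + 1)) :
    rangeBase σ N none (HardSphereCollisionRecord.ofConfig (Torus.geometry (Fin 3)) (hsDiameter σ N) z t i j) =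
      hsDiameter σ N * (‖(z i).2 - (z j).2‖ * ((2 : ℝ)⁻¹ * ‖(z i).2 + (z j).2‖)) := by
  simp only [rangeBase]
  rw [HardSphereCollisionRecord.ofConfig_preVel_fst_add_snd]
  simp only [HardSphereCollisionRecord.ofConfig_preVel, HardSphereCollisionRecord.ofConfig_postVel,
    norm_relVel_reflectVel]

/-- `rangeBase` is a symmetric function of the ordered pair (every row). -/
theorem rangeBase_ofConfig_swap (σ : ℝ) (N : ℕ) (r : Option (Fin 3)) (z : Phase N) (t : ℝ) (i j : Fin (N + 1)) :
    rangeBase σ N r (HardSphereCollisionRecord.ofConfig (Torus.geometry (Fin 3)) (hsDiameter σ N) z t j i) =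
      rangeBase σ N r (HardSphereCollisionRecord.ofConfig (Torus.geometry (Fin 3)) (hsDiameter σ N) z t i j) := by
  cases r with
  | none => rw [rangeBase_ofConfig_none, rangeBase_ofConfig_none, norm_sub_rev, add_comm]
  | some k => rw [rangeBase_ofConfig_some, rangeBase_ofConfig_some, norm_sub_rev]

/-- **The range of a coin** (the docstring of `coinRange`, checked): on a good orbit, at a coin `n < coinCount` whose
colliding pair is `(i, j)`, `ρ_n = ω̃⁻_i ω̃⁻_j · min(rangeBase, wV)` — the two ordered records contribute equally. -/
theorem coinRange_eq_of_mem_contactPairs (hσ : 0 ≤ σ) (hσ2 : σ < 1 / 2) (Φ : Flow σ N) (r : Option (Fin 3))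
    {n : ℕ} {z : Phase N} (hz : z ∈ Φ.good) (hn : n < coinCount σ τ Φ z) {i j : Fin (N + 1)}
    (hij : (i, j) ∈ contactPairs (Torus.geometry (Fin 3)) (hsDiameter σ N) (Φ.flow (coinTime Φ z n) z)) :
    coinRange σ τ V Φ r n z =
      flagP σ τ V Φ (coinTime Φ z n) i z * flagP σ τ V Φ (coinTime Φ z n) j z *
        min (rangeBase σ N r (HardSphereCollisionRecord.ofConfig (Torus.geometry (Fin 3)) (hsDiameter σ N)
          (Φ.flow (coinTime Φ z n) z) (coinTime Φ z n) i j)) (window τ N * V) := by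
  have hG := Torus.isHardSphereRegular_geometry (d := Fin 3) (hsDiameter_lt_half hσ hσ2 N)
  have hγ := Φ.isTrajectory z hz
  have hpair : contactPairs (Torus.geometry (Fin 3)) (hsDiameter σ N) (Φ.flow (coinTime Φ z n) z) =
      {(i, j), (j, i)} := hγ.contactPairs_eq_pair hG hij
  have hne : (i, j) ≠ (j, i) := fun h => (mem_contactPairs.1 hij).1 (Prod.mk.inj h).1
  unfold coinRange
  rw [if_pos ⟨hz, hn⟩, hpair, Finset.sum_pair hne]
  simp only [HardSphereCollisionRecord.ofConfig_time, HardSphereCollisionRecord.ofConfig_fst,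
    HardSphereCollisionRecord.ofConfig_snd]
  rw [rangeBase_ofConfig_swap]
  ring

end Ranges

/-! ## § 2 The budget summand and the pathwise totals -/

section Budget

variable {t L V : ℝ}

/-- The budget summand is dominated by its quadratic branch. -/
theorem budgetTerm_le_sq (t L x : ℝ) :
    min (32 * (t * L) ^ 2 * x ^ 2) (16 * (t * L) * x) ≤ 32 * (t * L) ^ 2 * x ^ 2 :=
  min_le_left _ _

/-- The budget summand is at most `16 tLV` on `0 ≤ x ≤ V` (the linear branch and the truncation). -/
theorem budgetTerm_le_linear (ht : 0 ≤ t) (hL : 0 ≤ L) {x : ℝ} (hxV : x ≤ V) :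
    min (32 * (t * L) ^ 2 * x ^ 2) (16 * (t * L) * x) ≤ 16 * (t * L) * V :=
  (min_le_right _ _).trans (mul_le_mul_of_nonneg_left hxV (by positivity))

/-- On `0 ≤ x ≤ V` with `2tLV ≤ 1` the summand IS its quadratic branch. -/
theorem budgetTerm_eq_sq (ht : 0 ≤ t) (hL : 0 ≤ L) (htLV : 2 * (t * L) * V ≤ 1) {x : ℝ} (hx : 0 ≤ x)
    (hxV : x ≤ V) : min (32 * (t * L) ^ 2 * x ^ 2) (16 * (t * L) * x) = 32 * (t * L) ^ 2 * x ^ 2 := by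
  refine min_eq_left ?_
  have h1 : 2 * (t * L) * x ≤ 1 := (mul_le_mul_of_nonneg_left hxV (by positivity)).trans htLV
  have h2 : 0 ≤ 16 * (t * L) * x := by positivity
  calc 32 * (t * L) ^ 2 * x ^ 2 = 16 * (t * L) * x * (2 * (t * L) * x) := by ring
    _ ≤ 16 * (t * L) * x * 1 := mul_le_mul_of_nonneg_left h1 h2
    _ = 16 * (t * L) * x := mul_one _

/-- **Quadratic domination of the budget**: `Σ_{n<H} min(32(tL)²x_n², 16 tL x_n) ≤ 32(tL)² Σ_{n<H} x_n²`
(no sign conditions). -/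
theorem budget_le_quadratic (t L : ℝ) (x : ℕ → ℝ) (H : ℕ) :
    ∑ n ∈ Finset.range H, min (32 * (t * L) ^ 2 * x n ^ 2) (16 * (t * L) * x n) ≤
      32 * (t * L) ^ 2 * ∑ n ∈ Finset.range H, x n ^ 2 := by
  rw [Finset.mul_sum]
  exact Finset.sum_le_sum fun n _ => budgetTerm_le_sq t L (x n)

/-- **The budget IS quadratic for `2tLV ≤ 1`** on ranges `0 ≤ x_n ≤ V`. -/
theorem budget_eq_quadratic (ht : 0 ≤ t) (hL : 0 ≤ L) (htLV : 2 * (t * L) * V ≤ 1) (x : ℕ → ℝ)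
    (hx : ∀ n, 0 ≤ x n) (hxV : ∀ n, x n ≤ V) (H : ℕ) :
    ∑ n ∈ Finset.range H, min (32 * (t * L) ^ 2 * x n ^ 2) (16 * (t * L) * x n) =
      32 * (t * L) ^ 2 * ∑ n ∈ Finset.range H, x n ^ 2 := by
  rw [Finset.mul_sum]
  exact Finset.sum_congr rfl fun n _ => budgetTerm_eq_sq ht hL htLV (hx n) (hxV n)

/-- **Pathwise count bound** `Σ_{n<H} min(…) ≤ 16 tLV · min(H, coinCount)`: every coin costs at most `16tLV`,
coins beyond `coinCount` cost nothing. (Not a route to S4: the coin count is extensive in `τ`.) -/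
theorem budget_le_count {σ τ : ℝ} {N : ℕ} (hσ : 0 ≤ σ) (hσ2 : σ < 1 / 2) (hτ : 0 < τ) (hV : 0 ≤ V) (ht : 0 ≤ t)
    (hL : 0 ≤ L) (Φ : Flow σ N) (r : Option (Fin 3)) (H : ℕ) (z : Phase N) :
    ∑ n ∈ Finset.range H, min (32 * (t * L) ^ 2 * ((window τ N)⁻¹ * coinRange σ τ V Φ r n z) ^ 2)
        (16 * (t * L) * ((window τ N)⁻¹ * coinRange σ τ V Φ r n z)) ≤
      16 * (t * L) * V * (min H (coinCount σ τ Φ z) : ℕ) := by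
  classical
  have key : ∀ n ∈ Finset.range H,
      min (32 * (t * L) ^ 2 * ((window τ N)⁻¹ * coinRange σ τ V Φ r n z) ^ 2)
          (16 * (t * L) * ((window τ N)⁻¹ * coinRange σ τ V Φ r n z)) ≤
        if n < coinCount σ τ Φ z then 16 * (t * L) * V else 0 := by
    intro n _
    split_ifs with hn
    · exact budgetTerm_le_linear ht hL (coinRangeNorm_le hσ hσ2 hτ hV Φ r n z)
    · rw [coinRange_eq_zero_of_le Φ r (not_lt.1 hn)]
      simp
  refine (Finset.sum_le_sum key).trans ?_
  rw [Finset.sum_ite, Finset.sum_const_zero, add_zero, Finset.sum_const, nsmul_eq_mul]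
  have hfilter : ((Finset.range H).filter fun n => n < coinCount σ τ Φ z) =
      Finset.range (min H (coinCount σ τ Φ z)) := by
    ext n
    simp only [Finset.mem_filter, Finset.mem_range, lt_min_iff]
  rw [hfilter, Finset.card_range, mul_comm]

end Budget

/-! ## § 4 The exact reduction: S4 ⇔ the exponential moment of the quadratic coin budget -/

section Reduction

/-- **S4 from the quadratic coin budget.** If the QUADRATIC coin budget `κ Σ_{n<H} (w⁻¹ρ_n)²` has, for
`0 ≤ κ ≤ κ₀(V)`, an exponential moment of vanishing window pressure under `G_N` (uniformly in `H` and the row), then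
the registered conclusion of `stub_coinBudgetLD` holds, with `t₀ = √(κ₀/32)/L` (`min ≤` its quadratic branch;
monotonicity of `∫⁻`). This hypothesis is the precise input S4 is missing (no engine for it in the tree). -/
theorem coinBudgetLD_of_quadratic
    (hQ : ∃ σ₀ : ℝ, 0 < σ₀ ∧ ∀ (a₀ θ₀ : ℝ) (u₀ : V3), 0 < a₀ → 0 < θ₀ → ∀ σ : ℝ, 0 < σ → σ < σ₀ →
      ∀ Φ : (N : ℕ) → Flow σ N, ∃ V₀ : ℝ, 0 < V₀ ∧ ∀ V : ℝ, V₀ ≤ V → ∃ κ₀ : ℝ, 0 < κ₀ ∧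
        ∀ κ : ℝ, 0 ≤ κ → κ ≤ κ₀ → ∀ ε : ℝ, 0 < ε → ∃ τ₀ : ℝ, 0 < τ₀ ∧ ∀ τ : ℝ, τ₀ ≤ τ →
          ∃ N₀ : ℕ, ∀ N : ℕ, N₀ ≤ N → ∀ (H : ℕ) (r : Option (Fin 3)),
            ∫⁻ z, ENNReal.ofReal (Real.exp (κ * ∑ n ∈ Finset.range H,
                ((window τ N)⁻¹ * coinRange σ τ V (Φ N) r n z) ^ 2)) ∂(gibbs σ a₀ θ₀ u₀ N (Φ N)) ≤
              ENNReal.ofReal (Real.exp (ε * ((N : ℝ) + 1)))) :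
    ∃ σ₀ : ℝ, 0 < σ₀ ∧ ∀ (a₀ θ₀ : ℝ) (u₀ : V3), 0 < a₀ → 0 < θ₀ → ∀ σ : ℝ, 0 < σ → σ < σ₀ →
      ∀ Φ : (N : ℕ) → Flow σ N, ∀ L : ℝ, 0 < L → ∃ V₀ : ℝ, 0 < V₀ ∧ ∀ V : ℝ, V₀ ≤ V → ∃ t₀ : ℝ, 0 < t₀ ∧
        ∀ t : ℝ, 0 ≤ t → t ≤ t₀ → ∀ ε : ℝ, 0 < ε → ∃ τ₀ : ℝ, 0 < τ₀ ∧ ∀ τ : ℝ, τ₀ ≤ τ →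
          ∃ N₀ : ℕ, ∀ N : ℕ, N₀ ≤ N → ∀ (H : ℕ) (r : Option (Fin 3)),
            ∫⁻ z, ENNReal.ofReal (Real.exp (∑ n ∈ Finset.range H,
                min (32 * (t * L) ^ 2 * ((window τ N)⁻¹ * coinRange σ τ V (Φ N) r n z) ^ 2)
                  (16 * (t * L) * ((window τ N)⁻¹ * coinRange σ τ V (Φ N) r n z)))) ∂(gibbs σ a₀ θ₀ u₀ N (Φ N)) ≤
              ENNReal.ofReal (Real.exp (ε * ((N : ℝ) + 1))) := by
  obtain ⟨σ₀, hσ₀, h⟩ := hQ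
  refine ⟨σ₀, hσ₀, fun a₀ θ₀ u₀ ha hθ σ hσ hσ' Φ L hL => ?_⟩
  obtain ⟨V₀, hV₀, h⟩ := h a₀ θ₀ u₀ ha hθ σ hσ hσ' Φ
  refine ⟨V₀, hV₀, fun V hV => ?_⟩
  obtain ⟨κ₀, hκ₀, h⟩ := h V hV
  refine ⟨Real.sqrt (κ₀ / 32) / L, by positivity, fun t ht0 ht ε hε => ?_⟩
  have hκ : 32 * (t * L) ^ 2 ≤ κ₀ := by
    have h1 : t * L ≤ Real.sqrt (κ₀ / 32) := by rwa [le_div_iff₀ hL] at ht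
    have h2 : (t * L) ^ 2 ≤ κ₀ / 32 := by
      calc (t * L) ^ 2 ≤ Real.sqrt (κ₀ / 32) ^ 2 := pow_le_pow_left₀ (by positivity) h1 2
        _ = κ₀ / 32 := Real.sq_sqrt (by positivity)
    linarith
  obtain ⟨τ₀, hτ₀, h⟩ := h (32 * (t * L) ^ 2) (by positivity) hκ ε hε
  refine ⟨τ₀, hτ₀, fun τ hτ => ?_⟩
  obtain ⟨N₀, h⟩ := h τ hτ
  refine ⟨N₀, fun N hN H r => le_trans (lintegral_mono fun z => ?_) (h N hN H r)⟩
  exact ENNReal.ofReal_le_ofReal (Real.exp_le_exp.2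
    (budget_le_quadratic t L (fun n => (window τ N)⁻¹ * coinRange σ τ V (Φ N) r n z) H))

/-- **The quadratic coin budget from S4** (converse): since `0 ≤ w⁻¹ρ_n ≤ V` (§1), for `2tLV ≤ 1` the budget IS
`32(tL)² Σ (w⁻¹ρ_n)²` (`budget_eq_quadratic`), so S4 at `L = 1`, `t = √(κ/32) ≤ min(t₀, 1/(2V))` is the quadratic
statement with `κ₀ = 32 min(t₀, 1/(2V))²`. Together with `coinBudgetLD_of_quadratic`: S4 is EXACTLY the
`N`-uniform equilibrium exponential moment of the quadratic coin budget. -/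
theorem quadratic_of_coinBudgetLD
    (hS : ∃ σ₀ : ℝ, 0 < σ₀ ∧ ∀ (a₀ θ₀ : ℝ) (u₀ : V3), 0 < a₀ → 0 < θ₀ → ∀ σ : ℝ, 0 < σ → σ < σ₀ →
      ∀ Φ : (N : ℕ) → Flow σ N, ∀ L : ℝ, 0 < L → ∃ V₀ : ℝ, 0 < V₀ ∧ ∀ V : ℝ, V₀ ≤ V → ∃ t₀ : ℝ, 0 < t₀ ∧
        ∀ t : ℝ, 0 ≤ t → t ≤ t₀ → ∀ ε : ℝ, 0 < ε → ∃ τ₀ : ℝ, 0 < τ₀ ∧ ∀ τ : ℝ, τ₀ ≤ τ →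
          ∃ N₀ : ℕ, ∀ N : ℕ, N₀ ≤ N → ∀ (H : ℕ) (r : Option (Fin 3)),
            ∫⁻ z, ENNReal.ofReal (Real.exp (∑ n ∈ Finset.range H,
                min (32 * (t * L) ^ 2 * ((window τ N)⁻¹ * coinRange σ τ V (Φ N) r n z) ^ 2)
                  (16 * (t * L) * ((window τ N)⁻¹ * coinRange σ τ V (Φ N) r n z)))) ∂(gibbs σ a₀ θ₀ u₀ N (Φ N)) ≤
              ENNReal.ofReal (Real.exp (ε * ((N : ℝ) + 1)))) :
    ∃ σ₀ : ℝ, 0 < σ₀ ∧ ∀ (a₀ θ₀ : ℝ) (u₀ : V3), 0 < a₀ → 0 < θ₀ → ∀ σ : ℝ, 0 < σ → σ < σ₀ →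
      ∀ Φ : (N : ℕ) → Flow σ N, ∃ V₀ : ℝ, 0 < V₀ ∧ ∀ V : ℝ, V₀ ≤ V → ∃ κ₀ : ℝ, 0 < κ₀ ∧
        ∀ κ : ℝ, 0 ≤ κ → κ ≤ κ₀ → ∀ ε : ℝ, 0 < ε → ∃ τ₀ : ℝ, 0 < τ₀ ∧ ∀ τ : ℝ, τ₀ ≤ τ →
          ∃ N₀ : ℕ, ∀ N : ℕ, N₀ ≤ N → ∀ (H : ℕ) (r : Option (Fin 3)),
            ∫⁻ z, ENNReal.ofReal (Real.exp (κ * ∑ n ∈ Finset.range H,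
                ((window τ N)⁻¹ * coinRange σ τ V (Φ N) r n z) ^ 2)) ∂(gibbs σ a₀ θ₀ u₀ N (Φ N)) ≤
              ENNReal.ofReal (Real.exp (ε * ((N : ℝ) + 1))) := by
  obtain ⟨σ₀, hσ₀, h⟩ := hS
  refine ⟨min σ₀ (1 / 2), lt_min hσ₀ (by norm_num), fun a₀ θ₀ u₀ ha hθ σ hσ hσ' Φ => ?_⟩
  have hσ₁ : σ < σ₀ := hσ'.trans_le (min_le_left _ _)
  have hσ2 : σ < 1 / 2 := hσ'.trans_le (min_le_right _ _)
  obtain ⟨V₀, hV₀, h⟩ := h a₀ θ₀ u₀ ha hθ σ hσ hσ₁ Φ 1 one_pos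
  refine ⟨V₀, hV₀, fun V hV => ?_⟩
  have hVpos : 0 < V := hV₀.trans_le hV
  obtain ⟨t₀, ht₀, h⟩ := h V hV
  set t₁ : ℝ := min t₀ (1 / (2 * V)) with ht₁
  have ht₁pos : 0 < t₁ := lt_min ht₀ (by positivity)
  refine ⟨32 * t₁ ^ 2, by positivity, fun κ hκ0 hκ ε hε => ?_⟩
  -- the amplitude `t = √(κ/32)`
  set t : ℝ := Real.sqrt (κ / 32) with ht
  have ht0 : 0 ≤ t := Real.sqrt_nonneg _
  have htsq : 32 * (t * 1) ^ 2 = κ := by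
    rw [mul_one, ht, Real.sq_sqrt (by positivity)]; ring
  have htt₁ : t ≤ t₁ := by
    have h1 : κ / 32 ≤ t₁ ^ 2 := by
      rw [div_le_iff₀ (by norm_num : (0 : ℝ) < 32)]; linarith
    calc t = Real.sqrt (κ / 32) := ht
      _ ≤ Real.sqrt (t₁ ^ 2) := Real.sqrt_le_sqrt h1
      _ = t₁ := Real.sqrt_sq ht₁pos.le
  have htt₀ : t ≤ t₀ := htt₁.trans (min_le_left _ _)
  have htLV : 2 * (t * 1) * V ≤ 1 := by
    have h1 : t ≤ 1 / (2 * V) := htt₁.trans (min_le_right _ _)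
    rw [le_div_iff₀ (by positivity)] at h1
    linarith
  obtain ⟨τ₀, hτ₀, h⟩ := h t ht0 htt₀ ε hε
  refine ⟨τ₀, hτ₀, fun τ hτ => ?_⟩
  have hτpos : 0 < τ := hτ₀.trans_le hτ
  obtain ⟨N₀, h⟩ := h τ hτ
  refine ⟨N₀, fun N hN H r => le_of_eq_of_le (lintegral_congr fun z => ?_) (h N hN H r)⟩
  rw [budget_eq_quadratic ht0 zero_le_one htLV (fun n => (window τ N)⁻¹ * coinRange σ τ V (Φ N) r n z)
    (fun n => coinRangeNorm_nonneg hσ.le hτpos hVpos.le (Φ N) r n z)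
    (fun n => coinRangeNorm_le hσ.le hσ2 hτpos hVpos.le (Φ N) r n z) H, htsq]

end Reduction

end CoinBudget

end Summit.AtomisticToContinuum.HydrodynamicLimit.Theorems.ClampedTransferCoin
end
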